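import Summits.CriticalPhenomena.PercolationContinuityZ3.Theorems.PercNearOneGluingNoHeavyQuantDepthOneGeneralRowLayers
import Summits.CriticalPhenomena.PercolationContinuityZ3.Theorems.PercNearOneGluingNoHeavyQuantPhantomRowsSharp
import HarnessLib

/-!
# QUANT lane R8, GRADED-CLOSURE programme: G₀ for EVERY PARTNER AT EVERY GATE — the rows above the small gated target by the light ♯-removal

builds on p205010 (kernel theorem, internal audit signed; external expert review pending)

Support file (`--supports stmt-CriticalPhenomena-4575`), QUANT lane seat prim-quant-arm-1 (gen 44, architect seat), rung R8 of
`run/shared/lean/prim/quant/LADDER.md`; memo `run/shared/lean/prim/quant/prim-quant-arm-1-g44/G0-SUBUNIT-G44.md` §10.  Theorems only, standard axioms,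
no sorries.

WHAT.  The node G₀ (`LawDec.TLCGateConvTLB`) is GATED: its hypotheses are the depth-1 rows of `gate μᵢ q` at the targets `q·Tᵢ` and its conclusion the two-layer
rows of `gate (lconv μ₁ μ₂) q` at `q·(T₁+T₂)`.  The rows `k < q·min Tᵢ` need nothing from the factors (`gateConv_row_belowTargets`, ✓ p377822, any floor).  This
file proves the rows ABOVE THE SMALL GATED TARGET, `q·T₂ ≤ k`, with `2k < q·T₁` and a heavy top hole, for EVERY partner and EVERY gate `0 < q ≤ 1`, by the
♯-REMOVAL of prim-quant-arm-1 g42 (`…QuantPhantomRowsSharp`: `sharp_tail_of_rowZero`, `gateConv_row_of_sharp` — no heaviness in those lemmas) composed with the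
ungated general-partner theorem in its layer-restricted form (`generalConv_twoLayerRow_of_tlcLayers`, `…QuantDepthOneGeneralRowLayers`):
let `ε = u(1−q)/q`, `θ = q(T₁+T₂) − k ≤ qT₁`; the gated two-layer row `0` of `μ₁` gives `μ₁{≥ θ} ≥ ε`; remove an `ε`-portion `φ` of `μ₁` from `{a ≥ θ}` — these atoms
are GIANTS of every top-low-capacity row of layer `≤ j₀ = ⌈θ⌉ − 1`, so `μ₁ − φ` keeps exactly those (ungated, target `qT₁`) rows, the slack `ε` of the gated rows paying
for the removed giants (`tlcLayers_of_gate_sub_portion`); `μ₂` keeps its ungated two-layer rows at `qT₂` (`tlbRows_of_gateRows`); the ungated theorem gives the row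
`k` of `(μ₁ − φ) ∗ μ₂` at `qT₁ + qT₂`; and `gateConv_row_of_sharp` turns it into the gated row.  With the mirror statement this covers, at every gate, every row
`k` of the node's conclusion with `2k < q·max(T₁,T₂)` whose top hole is heavy (automatic when `q·T_big − 2k ≥ q·T_small`), leaving the gated top band and the
light-hole rows (memo §6/§8).  HONEST STATUS: G₀ remains OPEN; nothing here changes the lane's RATE class log\* or honest sentence.

[this work]; ♯-removal: prim-quant-arm-1 g42; rows below the targets: prim-quant-arm-3 g165; depth-1 rows: prim-quant-census-2 g63/g64 (this lane).  Nothing here is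
cited as a published result.  The gluing rows served [cite: KozmaNitzan2024, Conjecture 3 (p. 15)]; product measure [cite: Grimmett1999, §1.3 p. 10].
-/

noncomputable section

namespace Summit.CriticalPhenomena.PercolationContinuityZ3.Theorems

namespace Quant

open Finset

namespace LawDec

/-- **ungating the partner's two-layer rows**: the gated rows of `μ₂` at target `τ` (`u·Σ_{b ≤ i} gate μ₂ q b ≤ Σ_{b ≥ τ−i} gate μ₂ q b`, `2i < τ`)
give the ungated rows of `μ₂` at the same target (the gate's atom at `0` only costs on the left). [this work] -/
theorem tlbRows_of_gateRows {y q τ : ℝ} {M : ℕ} {μ : ℕ → ℝ} (hy0 : 0 < y) (hy1 : y < 1) (hq0 : 0 < q) (hq1 : q ≤ 1)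
    (hrow : ∀ i : ℕ, 2 * (i : ℝ) < τ → y / (1 - y) * ∑ b ∈ Finset.range (i + 1), gate μ q b
      ≤ ∑ b ∈ Finset.range (M + 1), (if τ - i ≤ (b : ℝ) then gate μ q b else 0))
    (i : ℕ) (hi : 2 * (i : ℝ) < τ) :
    y / (1 - y) * ∑ b ∈ Finset.range (i + 1), μ b ≤ ∑ b ∈ Finset.range (M + 1), (if τ - i ≤ (b : ℝ) then μ b else 0) := by
  have h1y : 0 < 1 - y := by linarith
  have hu0 : 0 < y / (1 - y) := div_pos hy0 h1y
  have h := hrow i hi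
  have hi0 : (0 : ℝ) ≤ i := Nat.cast_nonneg i
  -- left: Σ gate = q Σ μ + (1 - q)
  have hL : ∑ b ∈ Finset.range (i + 1), gate μ q b = q * ∑ b ∈ Finset.range (i + 1), μ b + (1 - q) := by
    simp only [gate, Finset.sum_add_distrib, ← Finset.mul_sum]
    rw [Finset.sum_ite_eq' (Finset.range (i + 1)) 0, if_pos (Finset.mem_range.2 (Nat.succ_pos i))]
  -- right: the atom 0 is never `≥ τ - i > 0`
  have hR : ∑ b ∈ Finset.range (M + 1), (if τ - i ≤ (b : ℝ) then gate μ q b else 0)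
      = q * ∑ b ∈ Finset.range (M + 1), (if τ - i ≤ (b : ℝ) then μ b else 0) := by
    rw [Finset.mul_sum]
    refine Finset.sum_congr rfl fun b _ => ?_
    by_cases hb : τ - i ≤ (b : ℝ)
    · rw [if_pos hb, if_pos hb]
      simp only [gate]
      have hb0 : b ≠ 0 := by
        rintro rfl
        rw [Nat.cast_zero] at hb
        linarith
      rw [if_neg hb0]; ring
    · rw [if_neg hb, if_neg hb, mul_zero]
  rw [hL, hR] at h
  have hq1' : 0 ≤ 1 - q := by linarith
  have : q * (y / (1 - y) * ∑ b ∈ Finset.range (i + 1), μ b)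
      ≤ q * ∑ b ∈ Finset.range (M + 1), (if τ - i ≤ (b : ℝ) then μ b else 0) := by
    nlinarith [mul_nonneg hu0.le hq1']
  exact le_of_mul_le_mul_left this hq0

/-- **the de-phantomed factor keeps its top-low-capacity rows below the removed atoms.**  If the GATED law `gate μ₁ q` satisfies the
top-low-capacity row `(j, i)` at target `τ` and `φ ≥ 0` has total mass `u(1−q)/q` on `{0..M}` and vanishes below `θ > j`, then `μ₁ − φ`
satisfies the UNGATED row `(j, i)` at the same target: the removed atoms are giants of the row, and the gate's atom at `0` is exactly the slack. [this work] -/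
theorem tlcRow_of_gate_sub_portion {y q τ θ : ℝ} {M j i : ℕ} {μ φ : ℕ → ℝ} (hy0 : 0 < y) (hy1 : y < 1) (hq0 : 0 < q)
    (hφ0 : ∀ a, 0 ≤ φ a) (hφs : ∀ a : ℕ, (a : ℝ) < θ → φ a = 0)
    (hφ1 : ∑ a ∈ Finset.range (M + 1), φ a = y / (1 - y) * ((1 - q) / q))
    (hjθ : (j : ℝ) < θ) (hij : i ≤ j) (hlow : 2 * (i : ℝ) < τ)
    (hrow : y / (1 - y) * ∑ l ∈ Finset.range (i + 1), gate μ q l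
      ≤ ∑ h ∈ Finset.range (M + 1), (if j + 1 ≤ h then gate μ q h else 0)
        + y / (1 - y) * ∑ h ∈ Finset.range (M + 1), (if h ≤ j ∧ τ < (i : ℝ) + h then gate μ q h / usage y τ j i h else 0)) :
    y / (1 - y) * ∑ l ∈ Finset.range (i + 1), (μ l - φ l)
      ≤ ∑ h ∈ Finset.range (M + 1), (if j + 1 ≤ h then μ h - φ h else 0)
        + y / (1 - y) * ∑ h ∈ Finset.range (M + 1), (if h ≤ j ∧ τ < (i : ℝ) + h then (μ h - φ h) / usage y τ j i h else 0) := by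
  have h1y : 0 < 1 - y := by linarith
  have hu0 : 0 < y / (1 - y) := div_pos hy0 h1y
  have hi0 : (0 : ℝ) ≤ i := Nat.cast_nonneg i
  -- φ vanishes on lows and mids (atoms ≤ j < θ)
  have hφlow : ∀ l ∈ Finset.range (i + 1), φ l = 0 := fun l hl => by
    rw [Finset.mem_range] at hl
    exact hφs l (lt_of_le_of_lt (by exact_mod_cast (show l ≤ j by omega)) hjθ)
  have hφmid : ∀ h : ℕ, h ≤ j → φ h = 0 := fun h hh => hφs h (lt_of_le_of_lt (by exact_mod_cast hh) hjθ)
  -- left sides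
  have hL1 : ∑ l ∈ Finset.range (i + 1), (μ l - φ l) = ∑ l ∈ Finset.range (i + 1), μ l :=
    Finset.sum_congr rfl fun l hl => by rw [hφlow l hl, sub_zero]
  have hLg : ∑ l ∈ Finset.range (i + 1), gate μ q l = q * ∑ l ∈ Finset.range (i + 1), μ l + (1 - q) := by
    simp only [gate, Finset.sum_add_distrib, ← Finset.mul_sum]
    rw [Finset.sum_ite_eq' (Finset.range (i + 1)) 0, if_pos (Finset.mem_range.2 (Nat.succ_pos i))]
  -- giants: gated = q·μ (no atom 0 since j+1 ≥ 1); de-phantomed ≥ μ − φ with Σ_{giants} φ ≤ ε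
  have hGg : ∑ h ∈ Finset.range (M + 1), (if j + 1 ≤ h then gate μ q h else 0) = q * ∑ h ∈ Finset.range (M + 1), (if j + 1 ≤ h then μ h else 0) := by
    rw [Finset.mul_sum]
    refine Finset.sum_congr rfl fun h _ => ?_
    by_cases hh : j + 1 ≤ h
    · rw [if_pos hh, if_pos hh]; simp only [gate]; rw [if_neg (by omega)]; ring
    · rw [if_neg hh, if_neg hh, mul_zero]
  have hG1 : ∑ h ∈ Finset.range (M + 1), (if j + 1 ≤ h then μ h - φ h else 0)
      = ∑ h ∈ Finset.range (M + 1), (if j + 1 ≤ h then μ h else 0) - ∑ h ∈ Finset.range (M + 1), (if j + 1 ≤ h then φ h else 0) := by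
    rw [← Finset.sum_sub_distrib]
    exact Finset.sum_congr rfl fun h _ => by split_ifs <;> ring
  have hφgi : ∑ h ∈ Finset.range (M + 1), (if j + 1 ≤ h then φ h else 0) ≤ y / (1 - y) * ((1 - q) / q) := by
    rw [← hφ1]
    exact Finset.sum_le_sum fun h _ => by split_ifs; exacts [le_rfl, hφ0 h]
  -- mids: gated = q·μ, de-phantomed = μ (φ = 0 there)
  have hMg : ∑ h ∈ Finset.range (M + 1), (if h ≤ j ∧ τ < (i : ℝ) + h then gate μ q h / usage y τ j i h else 0)
      = q * ∑ h ∈ Finset.range (M + 1), (if h ≤ j ∧ τ < (i : ℝ) + h then μ h / usage y τ j i h else 0) := by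
    rw [Finset.mul_sum]
    refine Finset.sum_congr rfl fun h _ => ?_
    by_cases hh : h ≤ j ∧ τ < (i : ℝ) + h
    · rw [if_pos hh, if_pos hh]; simp only [gate]
      have hh0 : h ≠ 0 := by
        rintro rfl
        have h2 := hh.2
        rw [Nat.cast_zero, add_zero] at h2
        linarith
      rw [if_neg hh0]; ring
    · rw [if_neg hh, if_neg hh, mul_zero]
  have hM1 : ∑ h ∈ Finset.range (M + 1), (if h ≤ j ∧ τ < (i : ℝ) + h then (μ h - φ h) / usage y τ j i h else 0)
      = ∑ h ∈ Finset.range (M + 1), (if h ≤ j ∧ τ < (i : ℝ) + h then μ h / usage y τ j i h else 0) :=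
    Finset.sum_congr rfl fun h _ => by
      by_cases hh : h ≤ j ∧ τ < (i : ℝ) + h
      · rw [if_pos hh, if_pos hh, hφmid h hh.1, sub_zero]
      · rw [if_neg hh, if_neg hh]
  rw [hLg, hGg, hMg] at hrow
  rw [hL1, hG1, hM1]
  -- divide the gated row by q and use the slack u(1-q) ≥ q·Σ_{giants} φ
  set A := ∑ l ∈ Finset.range (i + 1), μ l
  set G := ∑ h ∈ Finset.range (M + 1), (if j + 1 ≤ h then μ h else 0)
  set C := ∑ h ∈ Finset.range (M + 1), (if h ≤ j ∧ τ < (i : ℝ) + h then μ h / usage y τ j i h else 0)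
  set P := ∑ h ∈ Finset.range (M + 1), (if j + 1 ≤ h then φ h else 0)
  -- hrow : u (qA + (1-q)) ≤ qG + u q C ;  goal: u A ≤ (G - P) + u C
  have hq : y / (1 - y) * A + y / (1 - y) * ((1 - q) / q) ≤ G + y / (1 - y) * C := by
    have := hrow
    have hqinv : 0 < 1 / q := by positivity
    have e1 : y / (1 - y) * (q * A + (1 - q)) = q * (y / (1 - y) * A + y / (1 - y) * ((1 - q) / q)) := by
      field_simp
    have e2 : q * G + y / (1 - y) * (q * C) = q * (G + y / (1 - y) * C) := by ring
    rw [e1, e2] at this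
    exact le_of_mul_le_mul_left this hq0
  linarith [hφgi]

/-- **G₀ FOR EVERY PARTNER AT EVERY GATE, rows above the small gated target** (see the file header).  Gated hypotheses of the node: the two-layer row
`0` and the top-low-capacity rows of layer `≤ j₀` of `gate μ₁ q` at `q·T₁`; the two-layer rows of `gate μ₂ q` at `q·T₂`; `μ₂` a probability law.  For
`q·T₂ ≤ k`, `2k < q·T₁`, product layer `j₀` (`j₀ < q(T₁+T₂) − k ≤ j₀ + 1`, `j₀ < M₁`), `m − 1 ≤ qT₁ − k < m`, and a heavy top hole
(`m ≤ j₀ → usage y (qT₁) j₀ k j₀ ≥ 1`, automatic when `qT₁ − 2k ≥ qT₂`): the two-layer row `k` of `gate (lconv M₁ M₂ μ₁ μ₂) q` at `q·(T₁+T₂)`. [this work] -/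
theorem gateConv_twoLayerRow_general {y q T₁ T₂ : ℝ} {M₁ M₂ k j₀ m : ℕ} {μ₁ μ₂ : ℕ → ℝ}
    (hy0 : 0 < y) (hy1 : y < 1) (hq0 : 0 < q) (hq1 : q ≤ 1)
    (h10 : ∀ h, 0 ≤ μ₁ h) (h1M : ∀ h, M₁ < h → μ₁ h = 0)
    (h20 : ∀ h, 0 ≤ μ₂ h) (h2M : ∀ h, M₂ < h → μ₂ h = 0) (h21 : ∑ h ∈ Finset.range (M₂ + 1), μ₂ h = 1)
    (hT1p : 0 < q * T₁) (hT20 : 0 < T₂)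
    (hrow0 : y / (1 - y) * ∑ h ∈ Finset.range (0 + 1), gate μ₁ q h
      ≤ ∑ h ∈ Finset.range (M₁ + 1), (if q * T₁ - (0 : ℕ) ≤ (h : ℝ) then gate μ₁ q h else 0))
    (hTLC1 : ∀ j i : ℕ, j ≤ j₀ → j < M₁ → i ≤ j → 2 * (i : ℝ) < q * T₁ →
      y / (1 - y) * ∑ l ∈ Finset.range (i + 1), gate μ₁ q l
        ≤ ∑ h ∈ Finset.range (M₁ + 1), (if j + 1 ≤ h then gate μ₁ q h else 0)
          + y / (1 - y) * ∑ h ∈ Finset.range (M₁ + 1), (if h ≤ j ∧ q * T₁ < (i : ℝ) + h then gate μ₁ q h / usage y (q * T₁) j i h else 0))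
    (hTLB2 : ∀ i : ℕ, 2 * (i : ℝ) < q * T₂ → y / (1 - y) * ∑ b ∈ Finset.range (i + 1), gate μ₂ q b
      ≤ ∑ b ∈ Finset.range (M₂ + 1), (if q * T₂ - i ≤ (b : ℝ) then gate μ₂ q b else 0))
    (hkT2 : q * T₂ ≤ k) (hlow : 2 * (k : ℝ) < q * T₁)
    (hj0 : (j₀ : ℝ) < q * (T₁ + T₂) - k) (hj0' : q * (T₁ + T₂) - k ≤ (j₀ : ℝ) + 1) (hj0M : j₀ < M₁)
    (hm : (m : ℝ) - 1 ≤ q * T₁ - k) (hm' : q * T₁ - k < (m : ℝ))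
    (hheavy : m ≤ j₀ → 1 ≤ usage y (q * T₁) j₀ k j₀) :
    y / (1 - y) * ∑ h ∈ Finset.range (k + 1), gate (lconv M₁ M₂ μ₁ μ₂) q h
      ≤ ∑ h ∈ Finset.range (M₁ + M₂ + 1), (if q * (T₁ + T₂) - k ≤ (h : ℝ) then gate (lconv M₁ M₂ μ₁ μ₂) q h else 0) := by
  have h1y : 0 < 1 - y := by linarith
  set θ : ℝ := q * (T₁ + T₂) - k with hθ
  have hθT : θ ≤ q * T₁ := by rw [hθ]; linarith
  have hθj : (j₀ : ℝ) < θ := hj0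
  -- the tail above θ and the ε-portion φ (as in `gateConv_row_aboveTarget_of_thmA`)
  have htail := sharp_tail_of_rowZero (θ := θ) hy0 hy1 hq0 h10 hT1p hθT hrow0
  set ε : ℝ := y / (1 - y) * ((1 - q) / q) with hε
  have hε0 : 0 ≤ ε := mul_nonneg (div_pos hy0 h1y).le (div_nonneg (by linarith) hq0.le)
  set S : ℝ := ∑ h ∈ Finset.range (M₁ + 1), (if θ ≤ (h : ℝ) then μ₁ h else 0) with hS
  have hS0 : 0 ≤ S := le_trans hε0 htail
  have hr0 : 0 ≤ ε / S := div_nonneg hε0 hS0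
  have hr1 : ε / S ≤ 1 := by
    rcases hS0.lt_or_eq with hpos | hzero
    · rw [div_le_one hpos]; exact htail
    · rw [← hzero, div_zero]; exact zero_le_one
  set φ : ℕ → ℝ := fun a => if θ ≤ (a : ℝ) then μ₁ a * (ε / S) else 0 with hφ
  have hφ0 : ∀ a, 0 ≤ φ a := fun a => by
    simp only [hφ]; split_ifs
    · exact mul_nonneg (h10 a) hr0
    · exact le_rfl
  have hφle : ∀ a, φ a ≤ μ₁ a := fun a => by
    simp only [hφ]; split_ifs
    · nlinarith [h10 a, hr1]
    · exact h10 a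
  have hφs : ∀ a : ℕ, (a : ℝ) < θ → φ a = 0 := fun a ha => by simp only [hφ, if_neg (not_le.mpr ha)]
  have hφM : ∀ a, M₁ < a → φ a = 0 := fun a ha => by simp only [hφ, h1M a ha, zero_mul, ite_self]
  have hφ1 : ∑ a ∈ Finset.range (M₁ + 1), φ a = y / (1 - y) * ((1 - q) / q) := by
    have e : ∑ a ∈ Finset.range (M₁ + 1), φ a = S * (ε / S) := by
      rw [hS, Finset.sum_mul]
      refine Finset.sum_congr rfl fun a _ => ?_
      simp only [hφ]; split_ifs
      · rfl
      · rw [zero_mul]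
    rw [e, ← hε]
    rcases hS0.lt_or_eq with hpos | hzero
    · field_simp
    · have hε00 : ε = 0 := le_antisymm (by rw [hzero]; exact htail) hε0
      rw [hε00, ← hzero, zero_mul]
  -- (i) the de-phantomed big factor keeps its top-low-capacity rows of layer ≤ j₀ (ungated, target qT₁)
  have hTLCν : ∀ j i : ℕ, j ≤ j₀ → j < M₁ → i ≤ j → 2 * (i : ℝ) < q * T₁ →
      y / (1 - y) * ∑ l ∈ Finset.range (i + 1), (μ₁ l - φ l)
        ≤ ∑ h ∈ Finset.range (M₁ + 1), (if j + 1 ≤ h then μ₁ h - φ h else 0)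
          + y / (1 - y) * ∑ h ∈ Finset.range (M₁ + 1),
              (if h ≤ j ∧ q * T₁ < (i : ℝ) + h then (μ₁ h - φ h) / usage y (q * T₁) j i h else 0) := by
    intro j i hjj hjM hij hlow'
    have hjθ : (j : ℝ) < θ := lt_of_le_of_lt (by exact_mod_cast hjj) hθj
    exact tlcRow_of_gate_sub_portion hy0 hy1 hq0 hφ0 hφs hφ1 hjθ hij hlow' (hTLC1 j i hjj hjM hij hlow')
  -- (ii) the partner's ungated two-layer rows at qT₂
  have hTLB2' : ∀ i : ℕ, 2 * (i : ℝ) < q * T₂ → y / (1 - y) * ∑ b ∈ Finset.range (i + 1), μ₂ b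
      ≤ ∑ b ∈ Finset.range (M₂ + 1), (if q * T₂ - i ≤ (b : ℝ) then μ₂ b else 0) :=
    fun i hi => tlbRows_of_gateRows hy0 hy1 hq0 hq1 hTLB2 i hi
  -- (iii) the ungated general-partner theorem for (μ₁ − φ, μ₂) at targets (qT₁, qT₂)
  have hA := generalConv_twoLayerRow_of_tlcLayers y (q * T₁) (q * T₂) M₁ M₂ k j₀ m (fun a => μ₁ a - φ a) μ₂
    hy0 hy1 (fun a => by linarith [hφle a]) h20 h2M (by positivity) hlow
    (by rw [← mul_add]; exact hj0) (by rw [← mul_add]; exact hj0') hj0M hm hm' hTLCν hTLB2' hheavy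
  rw [← mul_add] at hA
  -- (iv) the ♯ reduction
  have h2k : 2 * (k : ℝ) < q * (T₁ + T₂) := by nlinarith
  exact gateConv_row_of_sharp hy0 hy1 hq0 h21 (fun a ha => hφs a ha) hφ1 h2k hA

end LawDec

end Quant

end Summit.CriticalPhenomena.PercolationContinuityZ3.Theorems
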